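import Mathlib
import Summits.Ventures.PercRepro2.UniversalClosures
import Summits.Ventures.PercRepro2.V2SP

/-! # The level-exact variant of (UH*) is false
(seat mine-b, cell pub-perc-repro2; MINE-B.md §30.1)

`Universal r b` (UniversalClosures.lean) sends every slot `(x, i < b x)` of a source `x` (`r x = 0`,
`b x ≥ 1`) to a private target `y ≤ x` with `r y = 1` and `b y + 1 ≥ b x`.  The LEVEL-EXACT variant
`UniversalExact r b` asks for `b y + 1 = b x` instead.  It fails already on the five-edge series–parallel
network `(e ∗ e) ∧ (e ∗ e ∗ e)` — two parallel free edges in series with three parallel free edges: the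
three configurations with both first-stage edges blue and exactly one second-stage edge blue are sources
of level `1`, and a level-exact target below any of them must have blue flow `0` and red flow `1`, i.e.
exactly one first-stage edge blue and no second-stage edge blue — only two such configurations, for
three slots.  (On simple graphs the smallest failures have six vertices, e.g. `K₆ − {01, 23}` with the
terminals `0, 5` at level `2`; census MINE-B.md §30.1.)  So the slack `b y + 1 ≥ b x` of (UH*) — the
«drop ≤ 1» of the level relays of UniversalAlignedDefs.lean — is forced by the statement. -/

namespace Summit.Ventures.PercRepro2.UHClosure

open Finset

variable {X : Type*} [Preorder X] [Fintype X]

/-- the LEVEL-EXACT variant of `Universal`: every target sits exactly one blue level below its source -/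
def UniversalExact (r b : X → ℕ) : Prop :=
  ∃ f : SlotL (USrc r b) b → X, Function.Injective f ∧
    ∀ p : SlotL (USrc r b) b, f p ≤ p.1.1.1 ∧ r (f p) = 1 ∧ b p.1.1.1 = b (f p) + 1

/-- the level-exact variant implies (UH*) -/
theorem UniversalExact.universal {r b : X → ℕ} (h : UniversalExact r b) : Universal r b := by
  obtain ⟨f, hf, hspec⟩ := h
  exact ⟨f, hf, fun p => ⟨(hspec p).1, (hspec p).2.1, le_of_eq (hspec p).2.2⟩⟩

end Summit.Ventures.PercRepro2.UHClosure

namespace Summit.Ventures.PercRepro2.V2Closure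

open Finset Summit.Ventures.PercRepro2.UHClosure

/-- the network `(e ∗ e) ∧ (e ∗ e ∗ e)`: two parallel free edges in series with three parallel free edges -/
def twoThree : SP := SP.ser (SP.par .free .free) (SP.par (SP.par .free .free) .free)

/-- the three sources of level `1`: both first-stage edges blue, exactly one second-stage edge blue -/
def src23 (j : Fin 3) : twoThree.Conf :=
  match j with
  | 0 => ((true, true), ((true, false), false))
  | 1 => ((true, true), ((false, true), false))
  | 2 => ((true, true), ((false, false), true))

/-- the two level-exact targets: one first-stage edge blue, no second-stage edge blue -/
def tgt23 (i : Fin 2) : twoThree.Conf :=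
  match i with
  | 0 => ((true, false), ((false, false), false))
  | 1 => ((false, true), ((false, false), false))

/-- the three sources are sources of level `1` -/
lemma src23_spec (j : Fin 3) : twoThree.rLab (src23 j) = 0 ∧ twoThree.bLab (src23 j) = 1 := by
  fin_cases j <;> decide

/-- the configuration order of `twoThree`, coordinatewise (`red < blue` on each free edge) -/
lemma le_iff23 (a b : twoThree.Conf) :
    a ≤ b ↔ ((a.1.1 = true → b.1.1 = true) ∧ (a.1.2 = true → b.1.2 = true)) ∧
      (((a.2.1.1 = true → b.2.1.1 = true) ∧ (a.2.1.2 = true → b.2.1.2 = true)) ∧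
        (a.2.2 = true → b.2.2 = true)) :=
  Iff.rfl

/-- equality of configurations of `twoThree`, coordinatewise -/
lemma eq_iff23 (a b : twoThree.Conf) :
    a = b ↔ (a.1.1 = b.1.1 ∧ a.1.2 = b.1.2) ∧ ((a.2.1.1 = b.2.1.1 ∧ a.2.1.2 = b.2.1.2) ∧ a.2.2 = b.2.2) := by
  constructor
  · rintro rfl; exact ⟨⟨rfl, rfl⟩, ⟨rfl, rfl⟩, rfl⟩
  · rintro ⟨⟨h1, h2⟩, ⟨h3, h4⟩, h5⟩
    rcases a with ⟨⟨a1, a2⟩, ⟨⟨a3, a4⟩, a5⟩⟩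
    rcases b with ⟨⟨b1, b2⟩, ⟨⟨b3, b4⟩, b5⟩⟩
    simp only at h1 h2 h3 h4 h5
    subst h1 h2 h3 h4 h5; rfl

/-- every level-exact target below one of the three sources is one of the two targets -/
lemma tgt23_of (j : Fin 3) (y : twoThree.Conf) (hle : y ≤ src23 j) (hr : twoThree.rLab y = 1)
    (hb : twoThree.bLab (src23 j) = twoThree.bLab y + 1) : y = tgt23 0 ∨ y = tgt23 1 := by
  rw [le_iff23] at hle
  rcases y with ⟨⟨y₁, y₂⟩, ⟨⟨z₁, z₂⟩, z₃⟩⟩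
  fin_cases j <;> cases y₁ <;> cases y₂ <;> cases z₁ <;> cases z₂ <;> cases z₃ <;>
    simp_all [twoThree, src23, tgt23, SP.rLab, SP.bLab, serR, serB, parR, parB]

/-- the slot of index `0` of the source `j` -/
def slot23 (j : Fin 3) : SlotL (USrc twoThree.rLab twoThree.bLab) twoThree.bLab :=
  ⟨(⟨src23 j, ⟨(src23_spec j).1, (src23_spec j).2.symm ▸ le_rfl⟩, (src23_spec j).2.symm ▸ le_rfl⟩,
    ⟨0, Nat.lt_of_lt_of_le Nat.zero_lt_one ((src23_spec j).2.symm ▸ Nat.le_of_lt (lt_boundL _ _))⟩),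
    by simp [(src23_spec j).2]⟩

/-- the three slots are distinct -/
lemma slot23_injective : Function.Injective slot23 := by
  intro i j h
  have := congrArg (fun p => p.1.1.1) h
  fin_cases i <;> fin_cases j <;> simp_all [slot23, src23, eq_iff23]

/-- **THE LEVEL-EXACT VARIANT OF (UH*) IS FALSE** on `(e ∗ e) ∧ (e ∗ e ∗ e)`: three slots, two targets -/
theorem not_universalExact_twoThree : ¬ UniversalExact twoThree.rLab twoThree.bLab := by
  rintro ⟨f, hf, hspec⟩
  have key : ∀ j : Fin 3, f (slot23 j) = tgt23 0 ∨ f (slot23 j) = tgt23 1 := fun j =>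
    tgt23_of j (f (slot23 j)) (hspec (slot23 j)).1 (hspec (slot23 j)).2.1 (hspec (slot23 j)).2.2
  -- the map `j ↦ f (slot23 j)` is injective from `Fin 3` into the two-element set `{tgt23 0, tgt23 1}`
  have hinj : Function.Injective (fun j : Fin 3 => f (slot23 j)) := hf.comp slot23_injective
  have hrange : ∀ j : Fin 3, (fun j : Fin 3 => f (slot23 j)) j ∈ ({tgt23 0, tgt23 1} : Finset twoThree.Conf) := by
    intro j; rcases key j with h | h <;> simp [h]
  have hcard := Finset.card_le_card_of_injOn (fun j : Fin 3 => f (slot23 j))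
    (s := Finset.univ) (t := ({tgt23 0, tgt23 1} : Finset twoThree.Conf))
    (fun j _ => hrange j) (fun i _ j _ hij => hinj hij)
  have h2 : ({tgt23 0, tgt23 1} : Finset twoThree.Conf).card ≤ 2 := Finset.card_le_two
  simp at hcard
  omega

end Summit.Ventures.PercRepro2.V2Closure
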